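import Literature.NumberTheory.GelbartRogawski1991.LocalScaleModelTransportUndoubling
import Literature.NumberTheory.GelbartRogawski1991.LocalUnitarySplittingsCM
import HarnessLib

-- buildfix G11b-3 recipe (LEDGER B13-1/B13-3), as in the GelbartRogawski1991 siblings: elaborate sequentially so the
-- trailing `attribute [implicit_reducible]` block is in force at `.olean` export (inert for the kernel).
set_option Elab.async false

/-!
# The CM local splitting under the scale transport: undoubling identity and transported parabolic normalisation

Topic `NumberTheory/GelbartRogawski1991`; namespace `Literature.NumberTheory.GelbartRogawski1991.UnitaryDualPair.LocalSplitting`.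
KERNEL ONLY: theorems; no definition, no named fact, no `sorry`.  Cell hodgecm-mathlib, line a4-liuD3 (`stub_iso_of_params`
and the registered residual `stub_lineRigidityS6a_nonsplit`, step S6a), instance of `LocalScaleModelTransportUndoubling`
at THE CM DATA of [GelbartRogawski1991, §3.1 Prop. 3.1.1] as constructed in the tree (`localSplittingDatumCM`, doubled group,
Lagrangian `ℓ_Δ`; `localSplittingCMWith` its undoubling), for a symmetric `T₀` and its multiple `T₀′ = a•T₀`
(the two Gram data `a•T_V` of the members of [Liu2021, App. D Lem. D.1 (3)]'s family are multiples of ONE `T_V`):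

* §1 `parabolic_toRep_conj_localSplittingDatumCM` — the tree's parabolic normalisation of the CM datum
  (`localSplittingDatumCM_parabolic`, printed with Rao's operator `r(δ′)`) in OPERATOR form: for every `m` whose projection moves
  `ℓ_Δ` onto `ℓ_Y`, every `p ∈ P_Δ(F_v)` and every `Φ`,
  `(ω(m s_v(p) m⁻¹) Φ)(0) = χ_v(det_Δ p)⁻¹ · ∏_w ‖det_Δ p_w‖_w^{1/2} · Φ(0)` (conjugation computed through any implementer,
  `LocalSplittingDatum.toRep_conj_localSplitting_apply`).
* §2 `parabolic_toRep_conj_scaleTransport_localSplittingDatumCM` — the SCALE-TRANSPORTED doubled CM section of `T₀′ = a•T₀`,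
  a section of `H = U(T₀ ⊕ −T₀)` over `ι^𝔻_{δ/a}` into `S̃p(β_{T₀ ⊕ −T₀})`, satisfies the same clause with the same scalar
  (`parabolic_toRep_conj_scaleTransportSection`; `det_Δ`, `χ_v ∘ det_Δ` do not see the retyping).
* §3 `scaleTransportSection_localSplittingCMWith` — the undoubled CM splitting of `U(a•T₀)` transported to the `(T₀, δ/a)`-model
  IS the undoubling of the scale-transported doubled CM section (`scaleTransportSection_undoubleLoc`).

References: [GelbartRogawski1991] §3.1 Prop. 3.1.1 p. 455; [Kudla1994] §3 Thm. 3.1; [HarrisKudlaSweet1996] §1 (1.11)–(1.16);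
[MoeglinVignerasWaldspurger1987] Chap. 2 II.1; [Liu2021] App. D §D.1.
-/

set_option autoImplicit false

noncomputable section

open scoped Matrix
open NumberField IsDedekindDomain MeasureTheory
open Literature.RepresentationTheory.HeisenbergGroup
open Literature.NumberTheory.Automorphic Literature.NumberTheory.Automorphic.UnitaryGroup Literature.NumberTheory.Weil1964
open Literature.NumberTheory.GaloisRepresentations Literature.RepresentationTheory.HarrisKudlaSweet1996

namespace Literature.NumberTheory.GelbartRogawski1991.UnitaryDualPair.LocalSplitting

variable (L : Type) [Field L] [NumberField L] [IsCMField L] (v : HeightOneSpectrum (𝓞 (maximalRealSubfield L)))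
  [MeasurableSpace (v.adicCompletion (maximalRealSubfield L))] [BorelSpace (v.adicCompletion (maximalRealSubfield L))]
  (μ : Measure (v.adicCompletion (maximalRealSubfield L))) [μ.IsAddHaarMeasure]
  (n : ℕ) {T₀ T₀' : Matrix (Fin n) (Fin n) (maximalRealSubfield L)}

/-! ## §1 The CM datum's parabolic normalisation in operator form -/

/-- **the parabolic normalisation of the CM local splitting datum, operator form**: for every `m ∈ S̃p_ψ(𝕎^𝔻_v)` whose projection
carries `ℓ_Δ` onto `ℓ_Y`, every `p ∈ P_Δ(F_v)` and every `Φ`,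
`(ω(m s_v(p) m⁻¹) Φ)(0) = (∏_w χ_w⁻¹(det_Δ p_w))⁻¹ · (∏_w ‖det_Δ p_w‖_w^{1/2}) · Φ(0)`.
[cite: Kudla1994, Thm 3.1] [cite: HarrisKudlaSweet1996, §1 (1.16)] -/
theorem parabolic_toRep_conj_localSplittingDatumCM (hT₀ : T₀.IsSymm) (hT₀d : IsUnit T₀.det)
    {JD : Matrix (Fin (n + n)) (Fin (n + n)) L}
    (hJD : JD = (gramD (maximalRealSubfield L) n T₀).map (algebraMap (maximalRealSubfield L) L))
    (χ : HeckeCharacter L) (hχ : IsSplittingChar L 1 χ)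
    (m : LocalMp (maximalRealSubfield L) (n + n) (gramD (maximalRealSubfield L) n T₀) v)
    (hm : (deltaLagrangian (maximalRealSubfield L) v n).map (toLin (maximalRealSubfield L) v (MpPsi.proj _ m)) =
      lagrangianY (maximalRealSubfield L) (n + n) v)
    (p : UnitaryGroup.localPi L (IsCMField.complexConj L) (n + n) JD v)
    (hp : IsSiegelDelta (maximalRealSubfield L) L (IsCMField.complexConj L) (complexConj_imagUnit L) (imagUnit_ne_zero L)
      (imagUnit_mul_self L) v n hT₀ hJD p)
    (Φ : SchwartzBruhat (Fin (n + n) → v.adicCompletion (maximalRealSubfield L))) :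
    ((MpPsi.toRep (localSchrodinger (maximalRealSubfield L) (n + n) (gramD (maximalRealSubfield L) n T₀) v)
          (m * (localSplittingDatumCM L v μ n hT₀ hT₀d hJD χ hχ).localSplitting p * m⁻¹) Φ :
        SchwartzBruhat (Fin (n + n) → v.adicCompletion (maximalRealSubfield L))) :
        (Fin (n + n) → v.adicCompletion (maximalRealSubfield L)) → ℂ) 0 =
      (((chiDet (maximalRealSubfield L) L (IsCMField.complexConj L) v n
            (fun w' : PlacesOver L v => (χ.localComponent w'.1)⁻¹) p)⁻¹ : ℂˣ) : ℂ) *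
        ((∏ w' : PlacesOver L v,
            Real.sqrt ‖detDelta (maximalRealSubfield L) L (IsCMField.complexConj L) v n w' p‖ : ℝ) : ℂ) *
        ((Φ : SchwartzBruhat (Fin (n + n) → v.adicCompletion (maximalRealSubfield L))) :
          (Fin (n + n) → v.adicCompletion (maximalRealSubfield L)) → ℂ) 0 := by
  have h := LocalSplittingDatum.toRep_conj_localSplitting_apply (maximalRealSubfield L) L (IsCMField.complexConj L)
    (complexConj_imagUnit L) (imagUnit_ne_zero L) (imagUnit_mul_self L) v (localSplittingDatumCM L v μ n hT₀ hT₀d hJD χ hχ) m p Φ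
  rw [h]
  exact localSplittingDatumCM_parabolic L v μ n hT₀ hT₀d hJD χ hχ (MpPsi.proj _ m) hm p hp Φ

/-! ## §2 The scale-transported doubled CM section is normalised with the same scalar -/

section Scale

/- (every hypothesis explicit per declaration — no section `variable` carrying a Prop, per the gate's D-0026 readout) -/

/-- **the scale-transported doubled CM section of `T₀′ = a•T₀` satisfies the parabolic normalisation in the `(T₀, δ/a)`-model
with the same scalar** `χ_v(det_Δ p)⁻¹ · ∏_w ‖det_Δ p_w‖_w^{1/2}`. [cite: Kudla1994, Thm 3.1] [cite: HarrisKudlaSweet1996, §1 (1.16)] -/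
theorem parabolic_toRep_conj_scaleTransport_localSplittingDatumCM (a : (maximalRealSubfield L)ˣ) (hT₀ : T₀.IsSymm)
    (hT₀' : T₀'.IsSymm) (hT₀'d : IsUnit T₀'.det)
    (hDD : gramD (maximalRealSubfield L) n T₀' = (a : maximalRealSubfield L) • gramD (maximalRealSubfield L) n T₀)
    (χ : HeckeCharacter L) (hχ : IsSplittingChar L 1 χ)
    (m : LocalMp (maximalRealSubfield L) (n + n) (gramD (maximalRealSubfield L) n T₀) v)
    (hm : (deltaLagrangian (maximalRealSubfield L) v n).map (toLin (maximalRealSubfield L) v (MpPsi.proj _ m)) =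
      lagrangianY (maximalRealSubfield L) (n + n) v)
    (p : UnitaryGroup.localPi L (IsCMField.complexConj L) (n + n)
      ((gramD (maximalRealSubfield L) n T₀).map (algebraMap (maximalRealSubfield L) L)) v)
    (hp : IsSiegelDelta (maximalRealSubfield L) L (IsCMField.complexConj L) (conj_lineDelta (complexConj_imagUnit L) a)
      (lineDelta_ne_zero (imagUnit_ne_zero L) a) (lineDelta_mul_self (imagUnit_mul_self L) a) v n hT₀ rfl p)
    (Φ : SchwartzBruhat (Fin (n + n) → v.adicCompletion (maximalRealSubfield L))) :
    ((MpPsi.toRep (localSchrodinger (maximalRealSubfield L) (n + n) (gramD (maximalRealSubfield L) n T₀) v)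
          (m * scaleTransportSection (maximalRealSubfield L) L (IsCMField.complexConj L) (n + n) (complexConj_imagUnit L)
              (imagUnit_ne_zero L) (imagUnit_mul_self L) (gramD (maximalRealSubfield L) n T₀) (gramD (maximalRealSubfield L) n T₀')
              (gramD_isSymm (maximalRealSubfield L) n hT₀) (gramD_isSymm (maximalRealSubfield L) n hT₀') a hDD rfl rfl v
              (localSplittingDatumCM L v μ n hT₀' hT₀'d rfl χ hχ).localSplitting
              (localSplittingDatumCM L v μ n hT₀' hT₀'d rfl χ hχ).proj_localSplitting p * m⁻¹) Φ :
        SchwartzBruhat (Fin (n + n) → v.adicCompletion (maximalRealSubfield L))) :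
        (Fin (n + n) → v.adicCompletion (maximalRealSubfield L)) → ℂ) 0 =
      (((chiDet (maximalRealSubfield L) L (IsCMField.complexConj L) v n
            (fun w' : PlacesOver L v => (χ.localComponent w'.1)⁻¹) p)⁻¹ : ℂˣ) : ℂ) *
        ((∏ w' : PlacesOver L v,
            Real.sqrt ‖detDelta (maximalRealSubfield L) L (IsCMField.complexConj L) v n w' p‖ : ℝ) : ℂ) *
        ((Φ : SchwartzBruhat (Fin (n + n) → v.adicCompletion (maximalRealSubfield L))) :
          (Fin (n + n) → v.adicCompletion (maximalRealSubfield L)) → ℂ) 0 := by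
  have key := parabolic_toRep_conj_scaleTransportSection (maximalRealSubfield L) L (IsCMField.complexConj L)
    (complexConj_imagUnit L) (imagUnit_ne_zero L) (imagUnit_mul_self L) a v hT₀ hT₀' hDD rfl rfl
    (localSplittingDatumCM L v μ n hT₀' hT₀'d rfl χ hχ).localSplitting
    (localSplittingDatumCM L v μ n hT₀' hT₀'d rfl χ hχ).proj_localSplitting
    (fun p' => (((chiDet (maximalRealSubfield L) L (IsCMField.complexConj L) v n
            (fun w' : PlacesOver L v => (χ.localComponent w'.1)⁻¹) p')⁻¹ : ℂˣ) : ℂ) *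
        ((∏ w' : PlacesOver L v,
            Real.sqrt ‖detDelta (maximalRealSubfield L) L (IsCMField.complexConj L) v n w' p'‖ : ℝ) : ℂ))
    (fun m' hm' p' hp' Φ' => parabolic_toRep_conj_localSplittingDatumCM L v μ n hT₀' hT₀'d rfl χ hχ m' hm' p' hp' Φ') m hm p hp Φ
  rw [key]
  simp only [chiDet_scaleInl, detDelta_scaleInl]

end Scale

/-! ## §3 The undoubled CM splitting under the scale transport -/

section Undoubled

variable {J₀ J₀' : Matrix (Fin n) (Fin n) L}

/-- **the undoubled CM splitting `localSplittingCMWith … T₀′ … v μ` of `U(a•T₀)(F_v)`, transported to the `(T₀, δ/a)`-model, IS the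
undoubling of the scale-transported doubled CM section.** [cite: GelbartRogawski1991, §3.1 Prop. 3.1.1 p. 455 L1–3] -/
theorem scaleTransportSection_localSplittingCMWith (a : (maximalRealSubfield L)ˣ) (hT₀ : T₀.IsSymm) (hT₀' : T₀'.IsSymm)
    (hT₀d : IsUnit T₀.det) (hT₀'d : IsUnit T₀'.det) (hTT₀ : T₀' = (a : maximalRealSubfield L) • T₀)
    (hDD : gramD (maximalRealSubfield L) n T₀' = (a : maximalRealSubfield L) • gramD (maximalRealSubfield L) n T₀)
    (hJ₀ : J₀ = T₀.map (algebraMap (maximalRealSubfield L) L)) (hJ₀' : J₀' = T₀'.map (algebraMap (maximalRealSubfield L) L))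
    (χ : HeckeCharacter L) (hχ : IsSplittingChar L 1 χ) :
    scaleTransportSection (maximalRealSubfield L) L (IsCMField.complexConj L) n (complexConj_imagUnit L) (imagUnit_ne_zero L)
        (imagUnit_mul_self L) T₀ T₀' hT₀ hT₀' a hTT₀ hJ₀ hJ₀' v (localSplittingCMWith L n hT₀' hT₀'d hJ₀' χ hχ v μ)
        (proj_localSplittingCMWith L n hT₀' hT₀'d hJ₀' χ hχ v μ) =
      undoubleLoc (maximalRealSubfield L) L (IsCMField.complexConj L) v n hJ₀ rfl (conj_lineDelta (complexConj_imagUnit L) a)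
        (lineDelta_ne_zero (imagUnit_ne_zero L) a) (lineDelta_mul_self (imagUnit_mul_self L) a) hT₀ hT₀d
        (scaleTransportSection (maximalRealSubfield L) L (IsCMField.complexConj L) (n + n) (complexConj_imagUnit L)
          (imagUnit_ne_zero L) (imagUnit_mul_self L) (gramD (maximalRealSubfield L) n T₀) (gramD (maximalRealSubfield L) n T₀')
          (gramD_isSymm (maximalRealSubfield L) n hT₀) (gramD_isSymm (maximalRealSubfield L) n hT₀') a hDD rfl rfl v
          (localSplittingDatumCM L v μ n hT₀' hT₀'d rfl χ hχ).localSplitting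
          (localSplittingDatumCM L v μ n hT₀' hT₀'d rfl χ hχ).proj_localSplitting)
        (proj_scaleTransportSection (maximalRealSubfield L) L (IsCMField.complexConj L) (n + n) (complexConj_imagUnit L)
          (imagUnit_ne_zero L) (imagUnit_mul_self L) (gramD (maximalRealSubfield L) n T₀) (gramD (maximalRealSubfield L) n T₀')
          (gramD_isSymm (maximalRealSubfield L) n hT₀) (gramD_isSymm (maximalRealSubfield L) n hT₀') a hDD rfl rfl v
          (localSplittingDatumCM L v μ n hT₀' hT₀'d rfl χ hχ).localSplitting
          (localSplittingDatumCM L v μ n hT₀' hT₀'d rfl χ hχ).proj_localSplitting) :=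
  scaleTransportSection_undoubleLoc (maximalRealSubfield L) L (IsCMField.complexConj L) (complexConj_imagUnit L)
    (imagUnit_ne_zero L) (imagUnit_mul_self L) a v hT₀ hT₀' hT₀d hT₀'d hTT₀ hDD hJ₀ hJ₀' rfl rfl
    (localSplittingDatumCM L v μ n hT₀' hT₀'d rfl χ hχ).localSplitting
    (localSplittingDatumCM L v μ n hT₀' hT₀'d rfl χ hχ).proj_localSplitting

end Undoubled

/-! ### Build-lane note (ops-buildfix G11b-3 recipe, LEDGER B13-1, 2026-08-21)
As in the siblings: the public theorems with very large dependent binder telescopes are tagged `[implicit_reducible]` ONLY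
to keep them out of `lean -o`'s library-suggestion index (inert for the kernel; no statement or proof is changed). -/
set_option allowUnsafeReducibility true in
attribute [implicit_reducible]
  parabolic_toRep_conj_localSplittingDatumCM parabolic_toRep_conj_scaleTransport_localSplittingDatumCM
  scaleTransportSection_localSplittingCMWith

end Literature.NumberTheory.GelbartRogawski1991.UnitaryDualPair.LocalSplitting

end
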